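import Mathlib

/-!
# L-free subsets of a grid: `|S| ≤ #rows used + #columns used`
# (crux `LevelGradedCohnUmans.GradedDesignFamily`, stmt-MatrixMultiplication-7610; negative side,
# line `quadratic-extension-level-one-cell`, stub `card_le_of_lFree`)

A finite subset `S ⊆ R × C` of a grid is *L-free* if no point of `S` has BOTH a row-mate (another
point of `S` with the same first coordinate) AND a column-mate (another point of `S` with the same
second coordinate).  Then

* `card_le_of_lFree` — `|S| ≤ |S.image Prod.fst| + |S.image Prod.snd|`
  (the number of rows used plus the number of columns used).

Proof: split `S` into the points WITH a column-mate and the points WITHOUT one.  By L-freeness a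
point with a column-mate has no row-mate, so `Prod.fst` is injective on the first part, which
therefore has at most `|S.image Prod.fst|` elements; two points of the second part with the same
column would be column-mates of each other, so `Prod.snd` is injective on the second part, which
has at most `|S.image Prod.snd|` elements (`Finset.card_le_card_of_injOn` twice, glued by
`Finset.card_filter_add_card_filter_not`).

This is the combinatorial core of the torus-habitat bound of the line's negative programme: the grid
positions of a middle set `Y` inside a rationally split torus form an L-free subset of a
`(q + 1) × (q - 1)` grid (an "L" gives an alternating fibre path, forbidden by the fibre law
`not_frameSeparated_of_fibre_path`), whence `|Y| ≤ 2q(q + 1)`.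

Sorry-free; axioms `propext`, `Classical.choice`, `Quot.sound`.
-/

set_option linter.dupNamespace false

open scoped BigOperators

namespace Summit.MatrixMultiplication.MatrixMultiplication.Theorems.GradedDesignFamily.Negative

/-- **L-free sets in a grid.**  If no point of `S ⊆ R × C` has both a row-mate and a column-mate
in `S`, then `|S| ≤ #rows used + #columns used`, i.e.
`S.card ≤ (S.image Prod.fst).card + (S.image Prod.snd).card`. [folklore] -/
theorem card_le_of_lFree {R C : Type} [DecidableEq R] [DecidableEq C] (S : Finset (R × C))
    (hS : ∀ p ∈ S, (∃ p₁ ∈ S, p₁ ≠ p ∧ p₁.1 = p.1) → (∃ p₂ ∈ S, p₂ ≠ p ∧ p₂.2 = p.2) → False) :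
    S.card ≤ (S.image Prod.fst).card + (S.image Prod.snd).card := by
  classical
  -- points WITH a column-mate have no row-mate (L-freeness), so `Prod.fst` is injective on them
  have h₁ : (S.filter fun p => ∃ p₂ ∈ S, p₂ ≠ p ∧ p₂.2 = p.2).card ≤ (S.image Prod.fst).card := by
    refine Finset.card_le_card_of_injOn Prod.fst (fun p hp => ?_) ?_
    · exact Finset.mem_image_of_mem _ (Finset.mem_filter.1 hp).1
    · intro p hp p' hp' he
      obtain ⟨hpS, hpc⟩ := Finset.mem_filter.1 (Finset.mem_coe.1 hp)
      obtain ⟨hp'S, -⟩ := Finset.mem_filter.1 (Finset.mem_coe.1 hp')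
      by_contra hne
      exact hS p hpS ⟨p', hp'S, fun h => hne h.symm, he.symm⟩ hpc
  -- two points WITHOUT a column-mate in the same column would be column-mates of each other,
  -- so `Prod.snd` is injective on them
  have h₂ : (S.filter fun p => ¬ ∃ p₂ ∈ S, p₂ ≠ p ∧ p₂.2 = p.2).card ≤
      (S.image Prod.snd).card := by
    refine Finset.card_le_card_of_injOn Prod.snd (fun p hp => ?_) ?_
    · exact Finset.mem_image_of_mem _ (Finset.mem_filter.1 hp).1
    · intro p hp p' hp' he
      obtain ⟨-, hpc⟩ := Finset.mem_filter.1 (Finset.mem_coe.1 hp)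
      obtain ⟨hp'S, -⟩ := Finset.mem_filter.1 (Finset.mem_coe.1 hp')
      by_contra hne
      exact hpc ⟨p', hp'S, fun h => hne h.symm, he.symm⟩
  calc S.card = (S.filter fun p => ∃ p₂ ∈ S, p₂ ≠ p ∧ p₂.2 = p.2).card +
        (S.filter fun p => ¬ ∃ p₂ ∈ S, p₂ ≠ p ∧ p₂.2 = p.2).card :=
      (Finset.card_filter_add_card_filter_not _).symm
    _ ≤ (S.image Prod.fst).card + (S.image Prod.snd).card := Nat.add_le_add h₁ h₂

end Summit.MatrixMultiplication.MatrixMultiplication.Theorems.GradedDesignFamily.Negative
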